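import Literature.AnabelianGeometry.SemiGraphs.AmbientVocabReal
import Literature.AnabelianGeometry.SemiGraphs.AmbientVocabEmbedding
import Literature.AnabelianGeometry.SemiGraphs.LocalizationsAnabelioids
import Literature.AnabelianGeometry.SemiGraphs.ZariskiMainTheoremBaseChange

/-!
# [SemiAnbd] Prop 4.4 (Associated Anabelioids) at the real vocabulary `SemiAnbdVocab.ofReal R`: the formal legs

Mochizuki, *Semi-graphs of anabelioids*, Publ. RIMS **42** (2006), §4 Prop 4.4 (i)–(iv) p.54, proof
p.55 (kurims `paper:url-f33ace170ff4`): for morphisms `H → K`, `L → K` between finite objects of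
`Loc(𝔾, Γ)` — (i) after a finite étale base change `K' → K` every connected component of the pull-back
embeds into `K'`; (ii) some finite étale `K' → K` embeds into a finite étale covering `𝔾' → 𝔾`; (iii)
`H → K` "induces a relatively slim `π₁`-monomorphism of slim anabelioids `B(H) → B(K)` which completely
determines the original morphism"; (iv) if `H → K`, `L → K` are finite étale, "every morphism `H → L` in
`Loc(𝔾, Γ)` lying over `K` is finite étale and induces a finite étale morphism on associated anabelioids",
proof p.55: "assertion (iv) is a formal consequence of assertion (iii); Proposition 4.3, (iii); and the
definitions"; "the existence of a `K' → K` as asserted [in (ii)] follows by applying assertion (i) to the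
morphism `K''' → 𝔾`". [cite: MochizukiSemiAnbd2006, Prop 4.4, p. 54]

PROOF-ONLY (cell abc-iut, layer L3, seat abc-iut-L3-t12 gen 10, row «AMBIENT-VOCAB@PROP44» keyed by
the L3 lead gen 8 (δ2); pattern of abc-iut-L3-t3's `AmbientVocabProp43i.lean` / `AmbientVocabRealProp43iii.lean`;
no definition, no instance, nothing restated).  READING: the four typed nodes
`Loc.AssociatedAnabelioidsStatementI/II/III/IV` (`LocalizationsAnabelioids.lean`, abc-iut-L3-t3) are
predicates in TWO free containers — the §§1–4 container `𝓥`, here INSTANTIATED at the real vocabulary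
`SemiAnbdVocab.ofReal R` (`AmbientVocabOfReal.lean`; `SemiAnbdVocab.real` is `ofReal` at the instantiated
residual, `SemiAnbdVocab.real_eq_ofReal`), and the §2 stub-container `𝓐 : AnabelioidVocab SgA` of the
ANABELIOID-level data (`Π_H := π̂₁(B(H))`, the homomorphism `fundMap f` a locally open arrow induces, the
components of pull-backs of finite étale coverings), which carries NO laws and is NOT instantiated in the
tree (the functor `B(f) : B(K) ⥤ B(H)` of a 1-morphism, Rmk 2.11.1, is not in the tree for t1's model —
abc-iut-L3-t3 MERGE-MAP §4 item 3).  Statement (ii) does not mention `𝓐`.  Consequently, at `ofReal R`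
the nodes are proved here MODULO DISPLAYED LAWS on the free pair `(R, 𝓐)`, each law being either a
dictionary clause that an honest `AnabelioidVocab.ofReal` satisfies by construction, or one of print's
§1–§4 inputs written in `𝓐`-currency, named with its locator — hypotheses, not new facts:

* `Loc.injective_and_isOpen_range_of_over` — the group-theoretic heart of (iv): if `f = c · (g ∘ h) · c⁻¹`
  pointwise with `f` injective of open image and `g` injective continuous, then `h` is injective of open
  image (no container at all);
* ★ `Loc.associatedAnabelioidsStatementIV_ofReal_of_laws` — **Prop 4.4 (iv), first sentence, at `ofReal R`
  for every `R`, `𝓐`**, conjuncts «injective» and «open image» PROVED from (L-iv-b) «`fundMap` is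
  functorial up to an inner automorphism of the target» and (L-iv-c) «finite étale arrows induce injections
  with open image on `Π`» ([SemiAnbd] §2 p.23 `B(𝒢') = B(𝒢)_{G'}`, [GeoAn] Def 1.2.2) via the heart; the
  conjunct «`H → L` is finite étale» is carried as the displayed law (L-iv-a) — print derives it from
  (iii), Prop 4.3 (iii) and the full embedding `B(K)⁰ ↪ Loc(𝔾, Γ)_K`, none of which the tree has at
  `ofReal` (honest residual, recorded; NOT discharged here);
* `Loc.associatedAnabelioidsStatementIII_ofReal_of_laws` — (iii) ASSEMBLED from its three printed inputs in
  `𝓐`-currency: (L-iii-a) slimness of `Π_H` for finite objects (Cor 2.7 (ii)), (L-iii-b) injectivity of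
  `fundMap` ((i) + extension of finite graph-coverings, p.55), (L-iii-c) relative slimness and
  determination up to `Π_K`-inner automorphism (Prop 4.3 (v) + Cor 2.7 (i)(iii)) — CONDITIONAL-BY-NAME,
  no discharge claimed;
* `Loc.associatedAnabelioidsStatementII_ofReal_of_statementI` — **(ii) ⟸ (i)** as in print («applying
  assertion (i) to the morphism `K''' → 𝔾`»), modulo (L-ii-a) «every finite object `K` receives a finite
  étale `K''' → K` from a finite object admitting a `Loc`-arrow `K''' → 𝔾₀` to a closed object `𝔾₀` with
  underlying semi-graph of anabelioids `𝔾`» (p.55: combinatorial universal covering + Prop 4.3 (iv) +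
  finiteness — the CONSTRUCTION of print's proof, carried by name) and (L-ii-b) «pull-back components
  exist, their first projections are finite étale, finite étale ∘ finite étale is finite étale»
  (`𝓐`-dictionary + Def 2.2 (i));
* ★ `Loc.associatedAnabelioidsStatementI_ofReal_of_zmt` — **(i) ⟸ Thm 1.2 (ii) «Zariski's main theorem
  for semi-graphs», PROVED in the tree** (`SemiGraph.zariskiMainTheorem_baseChange_holds`, abc-iut-L3-t1
  lineage) — print p.55: «by Proposition 2.5, (i), we may reduce immediately to the case where the given
  morphism `H → K` is locally trivial. Thus, we are reduced to a problem in graph theory … Theorem 1.2» —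
  modulo the displayed law (L-i-a) = exactly that reduction in `(R, 𝓐)`-currency: after a finite étale
  base change `K₁ → K` the arrow has locally trivial pull-back components, presented by an immersion
  `φ : A → 𝔾(K₁)` of finite semi-graphs, and every finite graph-covering `π` of `𝔾(K₁)` is the base of a
  finite étale `K₂ → K₁` whose pull-back components have as bases the connected pieces of `A ×_{𝔾(K₁)} B'`
  (so that an embedding `H ↪ A ×_{𝔾(K₁)} B' → B'` makes the component's base an embedding) — with the landed
  dictionary `SemiAnbdVocab.ofReal_isGraphEmbedding_iff` (container embedding = t1's `SemiGraph.IsEmbedding`);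
* `_real` corollaries at the parameter-free `SemiAnbdVocab.real` (one universe, `SgA.{u,u,u}`).

Honest scope: `ofReal` results at general universes `SgA.{v₁, u₁, u}`; nothing here takes a side on
[IUTchIII] Cor. 3.12; typed ≠ proved; conditional ≠ discharged; the displayed laws ARE the residual
(= `AnabelioidVocab.ofReal`, MERGE-MAP §4 item 3, plus (L-iv-a), (L-ii-a), (L-i-a)); the graph theory
of (i) is the tree's theorem, its Prop 2.5 (i) reduction is not discharged here.
-/

namespace Literature.AnabelianGeometry.SemiGraphs

open CategoryTheory Literature.AlgebraicGeometry.Frobenioids Literature.AnabelianGeometry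

namespace Loc

/-! ### 1. The group-theoretic heart of (iv) -/

section Heart

variable {A B C : Type*} [Group A] [Group B] [Group C] [TopologicalSpace B] [TopologicalSpace C]
  [IsTopologicalGroup C]

/-- **The heart of Prop 4.4 (iv)**: if `f : A → C` agrees with `g ∘ h` up to the inner automorphism
of `c ∈ C`, `f` is injective with open image and `g : B → C` is injective and continuous, then
`h : A → B` is injective with open image — `range h = g⁻¹(c⁻¹ · range f · c)`.
[cite: MochizukiSemiAnbd2006, Prop 4.4 (iv), p. 54] -/
theorem injective_and_isOpen_range_of_over (h : A →* B) (g : B →* C) (f : A →* C) (c : C)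
    (hcomp : ∀ a, f a = c * g (h a) * c⁻¹) (hf : Function.Injective f)
    (hfo : IsOpen (Set.range f)) (hg : Function.Injective g) (hgc : Continuous g) :
    Function.Injective h ∧ IsOpen (Set.range h) := by
  refine ⟨fun a a' haa => hf (by rw [hcomp a, hcomp a', haa]), ?_⟩
  -- the open set `{y | c * y * c⁻¹ ∈ range f}` pulls back under `g` to `range h`
  have hT : IsOpen {y : C | c * y * c⁻¹ ∈ Set.range f} :=
    hfo.preimage ((continuous_const.mul continuous_id).mul continuous_const)
  have key : Set.range h = g ⁻¹' {y : C | c * y * c⁻¹ ∈ Set.range f} := by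
    ext b
    simp only [Set.mem_range, Set.mem_preimage, Set.mem_setOf_eq]
    constructor
    · rintro ⟨a, rfl⟩
      exact ⟨a, hcomp a⟩
    · rintro ⟨a, ha⟩
      refine ⟨a, (hg ?_).symm⟩
      have := ha.symm.trans (hcomp a)
      exact mul_left_cancel (mul_right_cancel this)
  rw [key]
  exact hT.preimage hgc

end Heart

/-! ### 2. Proposition 4.4 at `SemiAnbdVocab.ofReal R` (every residual `R`, every `𝓐`) -/

open SgAQuot SgAQuot.SgA

universe v₁ u₁ u w

variable (R : SgA.BridgeResidual.{v₁, u₁, u}) (𝓐 : AnabelioidVocab SgA.{v₁, u₁, u})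
  (G : SgA.{v₁, u₁, u}) (Γ : Subgroup (Aut G))

/-- **[SemiAnbd] Prop 4.4 (iv), first sentence, at the real vocabulary `SemiAnbdVocab.ofReal R`** (every
residual `R`, every anabelioid container `𝓐`): for `H → K`, `L → K` finite étale between finite objects of
`Loc(𝔾, Γ)`, every morphism `H → L` over `K` is finite étale and induces on `Π` an injection with open image
— the last two conjuncts PROVED (`injective_and_isOpen_range_of_over`) from the displayed laws (L-iv-b)
«`𝓐.fundMap` is functorial up to an inner automorphism of the target» (a representative of the induced
OUTER homomorphism, §2 p.23) and (L-iv-c) «finite étale arrows induce injections with open image on `Π`»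
(§2 p.23 / [GeoAn] Def 1.2.2), the first conjunct being the displayed law (L-iv-a) (print p.55: from
(iii), Prop 4.3 (iii) and the definitions — NOT discharged here).  Conditional ≠ discharged.
[cite: MochizukiSemiAnbd2006, Prop 4.4 (iv), p. 54] -/
theorem associatedAnabelioidsStatementIV_ofReal_of_laws
    (hiva : LocHypotheses (SemiAnbdVocab.ofReal R) G Γ →
      ∀ {X Z Y : LocObj (SemiAnbdVocab.ofReal R) G Γ} (f : X ⟶ Y) (g : Z ⟶ Y) (h : X ⟶ Z),
        X.IsFiniteObj (SemiAnbdVocab.ofReal R) → Y.IsFiniteObj (SemiAnbdVocab.ofReal R) →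
          Z.IsFiniteObj (SemiAnbdVocab.ofReal R) →
            finiteEtale f.hom.hom.hom → finiteEtale g.hom.hom.hom → h ≫ g = f →
              finiteEtale h.hom.hom.hom)
    (hivb : ∀ {H L K : SgA.{v₁, u₁, u}} (h : H ⟶ L) (g : L ⟶ K),
      ∃ c : 𝓐.fundGroup K, ∀ a, 𝓐.fundMap (h ≫ g) a = c * 𝓐.fundMap g (𝓐.fundMap h a) * c⁻¹)
    (hivc : ∀ {H K : SgA.{v₁, u₁, u}} (q : H ⟶ K), finiteEtale q.hom.hom →
      Function.Injective (𝓐.fundMap q) ∧ IsOpen (Set.range (𝓐.fundMap q))) :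
    AssociatedAnabelioidsStatementIV (SemiAnbdVocab.ofReal R) 𝓐 G Γ := by
  intro hLoc X Z Y f g h hX hY hZ hf hg hhg
  have hh : finiteEtale h.hom.hom.hom := hiva hLoc f g h hX hY hZ hf hg hhg
  refine ⟨hh, ?_⟩
  -- `Π_H → Π_L → Π_K` agrees with `Π_H → Π_K` up to an inner automorphism of `Π_K`
  obtain ⟨c, hc⟩ := hivb h.hom g.hom
  have hfg : (h ≫ g).hom = h.hom ≫ g.hom := rfl
  obtain ⟨hfi, hfo⟩ := hivc f.hom hf
  obtain ⟨hgi, -⟩ := hivc g.hom hg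
  refine injective_and_isOpen_range_of_over (𝓐.fundMap h.hom) (𝓐.fundMap g.hom) (𝓐.fundMap f.hom) c
    (fun a => ?_) hfi hfo hgi (𝓐.continuous_fundMap g.hom)
  rw [← hhg]
  exact hc a

/-- **[SemiAnbd] Prop 4.4 (iii) at `SemiAnbdVocab.ofReal R`, ASSEMBLED from its printed inputs in
`𝓐`-currency** (CONDITIONAL-BY-NAME; no discharge claimed): (L-iii-a) «`B(H)` is slim for every finite
object `H`» (print: Cor 2.7 (ii)); (L-iii-b) «`B(H) → B(K)` is a `π₁`-monomorphism» (print p.55: by (i) and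
the extension of finite graph-coverings of a connected sub-semi-graph); (L-iii-c) «it is relatively slim
and completely determines `H → K` [up to `Π_K`-inner automorphism]» (print: Prop 4.3 (v) reduces to nuclear
`H`, then Cor 2.7 (i), (ii), (iii)). [cite: MochizukiSemiAnbd2006, Prop 4.4 (iii), p. 54] -/
theorem associatedAnabelioidsStatementIII_ofReal_of_laws
    (hiiia : LocHypotheses (SemiAnbdVocab.ofReal R) G Γ →
      ∀ X : LocObj (SemiAnbdVocab.ofReal R) G Γ, X.IsFiniteObj (SemiAnbdVocab.ofReal R) →
        IsSlimGroup (𝓐.fundGroup X.U))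
    (hiiib : LocHypotheses (SemiAnbdVocab.ofReal R) G Γ →
      ∀ {X Y : LocObj (SemiAnbdVocab.ofReal R) G Γ} (f : X ⟶ Y),
        X.IsFiniteObj (SemiAnbdVocab.ofReal R) → Y.IsFiniteObj (SemiAnbdVocab.ofReal R) →
          Function.Injective (𝓐.fundMap f.hom))
    (hiiic : LocHypotheses (SemiAnbdVocab.ofReal R) G Γ →
      ∀ {X Y : LocObj (SemiAnbdVocab.ofReal R) G Γ} (f : X ⟶ Y),
        X.IsFiniteObj (SemiAnbdVocab.ofReal R) → Y.IsFiniteObj (SemiAnbdVocab.ofReal R) →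
          AbsoluteAnabelian.IsRelativelySlim (𝓐.fundMap f.hom) ∧
            ∀ f' : X ⟶ Y, (∃ k : 𝓐.fundGroup Y.U, ∀ g, 𝓐.fundMap f'.hom g =
              k * 𝓐.fundMap f.hom g * k⁻¹) → f' = f) :
    AssociatedAnabelioidsStatementIII (SemiAnbdVocab.ofReal R) 𝓐 G Γ := by
  intro hLoc X Y f hX hY
  obtain ⟨hrs, hdet⟩ := hiiic hLoc f hX hY
  exact ⟨hiiia hLoc X hX, hiiia hLoc Y hY, hiiib hLoc f hX hY, hrs, hdet⟩

/-- Retargeting a finite étale arrow along an equality of objects keeps it finite étale.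
[cite: MochizukiSemiAnbd2006, Def 2.2 (i), p. 23] -/
theorem finiteEtale_comp_eqToHom {G' A B : SgA.{v₁, u₁, u}} (q : G' ⟶ A) (e : A = B)
    (hq : finiteEtale q.hom.hom) : finiteEtale (q ≫ eqToHom e).hom.hom := by
  subst e
  simpa using hq

/-- **[SemiAnbd] Prop 4.4 (ii) ⟸ Prop 4.4 (i) at `SemiAnbdVocab.ofReal R`**, as in print (p.55: «the
existence of a `K' → K` as asserted follows by applying assertion (i) to the morphism `K''' → 𝔾`»),
modulo the displayed laws (L-ii-a) «every finite object `K` receives a finite étale arrow `K''' → K` from a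
finite object `K'''` admitting a `Loc`-arrow `K''' → 𝔾₀` to a finite (closed) object `𝔾₀` whose underlying
semi-graph of anabelioids is `𝔾`» (print p.55: a finite sub-covering of the combinatorial universal
covering `K'' → K`, via Prop 4.3 (iv) and finiteness — the CONSTRUCTION of the proof, carried by name)
and (L-ii-b) «the pull-back of a finite étale `𝔾' → 𝔾` along `K''' → 𝔾₀` has a component, its first
projection is finite étale, and finite étale arrows compose» (`𝓐`-dictionary, Def 2.2 (i) p.23).
Conditional ≠ discharged. [cite: MochizukiSemiAnbd2006, Prop 4.4 (ii), p. 54] -/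
theorem associatedAnabelioidsStatementII_ofReal_of_statementI
    (hi : AssociatedAnabelioidsStatementI (SemiAnbdVocab.ofReal R) 𝓐 G Γ)
    (hiia : LocHypotheses (SemiAnbdVocab.ofReal R) G Γ →
      ∀ Y : LocObj (SemiAnbdVocab.ofReal R) G Γ, Y.IsFiniteObj (SemiAnbdVocab.ofReal R) →
        ∃ (X G₀ : LocObj (SemiAnbdVocab.ofReal R) G Γ) (t : X ⟶ Y),
          Nonempty (X ⟶ G₀) ∧ G₀.U = G ∧ X.IsFiniteObj (SemiAnbdVocab.ofReal R) ∧
            G₀.IsFiniteObj (SemiAnbdVocab.ofReal R) ∧ finiteEtale t.hom.hom.hom)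
    (hiib : ∀ {H K K' : SgA.{v₁, u₁, u}} (s : H ⟶ K) (q : K' ⟶ K), finiteEtale q.hom.hom →
      ∃ c ∈ 𝓐.pullbackComponents s q, finiteEtale c.2.1.hom.hom)
    (hiic : ∀ {H L K : SgA.{v₁, u₁, u}} (a : H ⟶ L) (b : L ⟶ K),
      finiteEtale a.hom.hom → finiteEtale b.hom.hom → finiteEtale (a ≫ b).hom.hom) :
    AssociatedAnabelioidsStatementII (SemiAnbdVocab.ofReal R) G Γ := by
  intro hLoc Y hY
  obtain ⟨X, G₀, t, ⟨s⟩, e, hX, hG₀, ht⟩ := hiia hLoc Y hY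
  -- (i) applied to `K''' → 𝔾₀`
  obtain ⟨G', q, hq, hemb⟩ := hi hLoc X G₀ s hX hG₀
  obtain ⟨c, hc, hc1⟩ := hiib s.hom q hq
  exact ⟨c.1, c.2.1 ≫ t.hom, G', q ≫ eqToHom e, c.2.2, hiic _ _ hc1 ht,
    finiteEtale_comp_eqToHom q e hq, hemb c hc⟩

/-- **[SemiAnbd] Prop 4.4 (i) at `SemiAnbdVocab.ofReal R` ⟸ Thm 1.2 (ii) («Zariski's main theorem for
semi-graphs», base-change form), which is PROVED in the tree** (`SemiGraph.zariskiMainTheorem_baseChange_holds`):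
print p.55 «Since `K` is quasi-coherent, it follows from Proposition 2.5, (i), that we may reduce immediately
to the case where the given morphism `H → K` is locally trivial. Thus, we are reduced to a problem in graph
theory — a problem solved in §1 — cf. Theorem 1.2».  The displayed law (L-i-a) is that reduction, in
`(R, 𝓐)`-currency: a finite étale base change `p₁ : K₁ → K` after which the arrow is presented by an
IMMERSION `φ : A → 𝔾(K₁)` of finite semi-graphs (Prop 2.5 (i); injective type), together with the
realisation of every finite graph-covering `π : B' → 𝔾(K₁)` as the base of a finite étale `p₂ : K₂ → K₁`
whose pull-back components (of the original arrow along `p₂ ≫ p₁`) are locally trivial with bases the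
connected pieces `H` of `A ×_{𝔾(K₁)} B'` — so that `H ↪ A ×_{𝔾(K₁)} B' → B'` an embedding makes the
component's base an embedding; (L-i-b): finite étale arrows compose (Def 2.2 (i)).  Given these, Thm 1.2
(ii) supplies `π` with ALL the `H ↪ A ×_{𝔾(K₁)} B' → B'` embeddings, and the container's «embedding» is
t1's (`SemiAnbdVocab.ofReal_isGraphEmbedding_iff`).  Conditional ≠ discharged.
[cite: MochizukiSemiAnbd2006, Prop 4.4 (i), p. 54] -/
theorem associatedAnabelioidsStatementI_ofReal_of_zmt
    (hia : LocHypotheses (SemiAnbdVocab.ofReal R) G Γ →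
      ∀ {X Y : LocObj (SemiAnbdVocab.ofReal R) G Γ} (f : X ⟶ Y),
        X.IsFiniteObj (SemiAnbdVocab.ofReal R) → Y.IsFiniteObj (SemiAnbdVocab.ofReal R) →
          ∃ (Y₁ : SgA.{v₁, u₁, u}) (p₁ : Y₁ ⟶ Y.U) (A : SemiGraph.{u}) (φ : A ⟶ Y₁.toSgA.graph),
            finiteEtale p₁.hom.hom ∧ A.IsFinite ∧ Y₁.toSgA.graph.IsFinite ∧ SemiGraph.IsImmersion φ ∧
              ∀ (B' : SemiGraph.{u}) (π : B' ⟶ Y₁.toSgA.graph), SemiGraph.IsFiniteGraphCovering π →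
                ∃ (Y₂ : SgA.{v₁, u₁, u}) (p₂ : Y₂ ⟶ Y₁), finiteEtale p₂.hom.hom ∧
                  ∀ c ∈ 𝓐.pullbackComponents f.hom (p₂ ≫ p₁),
                    locallyTrivial c.2.2.hom.hom ∧
                      ∃ H : (SemiGraph.pullback φ π).Subgraph, H.toSemiGraph.IsConnected ∧
                        (SemiGraph.IsEmbedding (H.ι ≫ SemiGraph.pullback.snd φ π) →
                          SemiGraph.IsEmbedding c.2.2.hom.hom.base))
    (hib : ∀ {H L K : SgA.{v₁, u₁, u}} (a : H ⟶ L) (b : L ⟶ K),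
      finiteEtale a.hom.hom → finiteEtale b.hom.hom → finiteEtale (a ≫ b).hom.hom) :
    AssociatedAnabelioidsStatementI (SemiAnbdVocab.ofReal R) 𝓐 G Γ := by
  intro hLoc X Y f hX hY
  obtain ⟨Y₁, p₁, A, φ, hp₁, hA, hB, hφ, hrest⟩ := hia hLoc f hX hY
  -- Zariski's main theorem for semi-graphs (Thm 1.2 (ii)), proved in the tree
  obtain ⟨B', π, hπ, hemb⟩ := SemiGraph.zariskiMainTheorem_baseChange_holds A _ φ hA hB hφ
  obtain ⟨Y₂, p₂, hp₂, hcomp⟩ := hrest B' π hπ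
  refine ⟨Y₂, p₂ ≫ p₁, hib _ _ hp₂ hp₁, fun c hc => ?_⟩
  obtain ⟨hlt, H, hH, himp⟩ := hcomp c hc
  exact ⟨hlt, (SemiAnbdVocab.ofReal_isGraphEmbedding_iff R _).mpr (himp (hemb H hH))⟩

/-! ### 3. At the parameter-free real vocabulary `SemiAnbdVocab.real` -/

/-- **Prop 4.4 (iv), first sentence, at `SemiAnbdVocab.real`** (`SgA.{u,u,u}`; every `𝓐`), modulo the three
displayed laws of `associatedAnabelioidsStatementIV_ofReal_of_laws` (`SemiAnbdVocab.real_eq_ofReal` is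
`rfl`). [cite: MochizukiSemiAnbd2006, Prop 4.4 (iv), p. 54] -/
theorem associatedAnabelioidsStatementIV_real_of_laws (𝓐 : AnabelioidVocab SgA.{u, u, u})
    (G : SgA.{u, u, u}) (Γ : Subgroup (Aut G))
    (hiva : LocHypotheses SemiAnbdVocab.real.{u} G Γ →
      ∀ {X Z Y : LocObj SemiAnbdVocab.real.{u} G Γ} (f : X ⟶ Y) (g : Z ⟶ Y) (h : X ⟶ Z),
        X.IsFiniteObj SemiAnbdVocab.real.{u} → Y.IsFiniteObj SemiAnbdVocab.real.{u} →
          Z.IsFiniteObj SemiAnbdVocab.real.{u} →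
            finiteEtale f.hom.hom.hom → finiteEtale g.hom.hom.hom → h ≫ g = f →
              finiteEtale h.hom.hom.hom)
    (hivb : ∀ {H L K : SgA.{u, u, u}} (h : H ⟶ L) (g : L ⟶ K),
      ∃ c : 𝓐.fundGroup K, ∀ a, 𝓐.fundMap (h ≫ g) a = c * 𝓐.fundMap g (𝓐.fundMap h a) * c⁻¹)
    (hivc : ∀ {H K : SgA.{u, u, u}} (q : H ⟶ K), finiteEtale q.hom.hom →
      Function.Injective (𝓐.fundMap q) ∧ IsOpen (Set.range (𝓐.fundMap q))) :
    Literature.AnabelianGeometry.SemiGraphs.Loc.AssociatedAnabelioidsStatementIV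
      SemiAnbdVocab.real.{u} 𝓐 G Γ :=
  associatedAnabelioidsStatementIV_ofReal_of_laws SgA.BridgeResidual.real 𝓐 G Γ hiva hivb hivc

/-- **Prop 4.4 (ii) ⟸ Prop 4.4 (i) at `SemiAnbdVocab.real`** (`SgA.{u,u,u}`), modulo the displayed laws of
`associatedAnabelioidsStatementII_ofReal_of_statementI`. [cite: MochizukiSemiAnbd2006, Prop 4.4 (ii), p. 54] -/
theorem associatedAnabelioidsStatementII_real_of_statementI (𝓐 : AnabelioidVocab SgA.{u, u, u})
    (G : SgA.{u, u, u}) (Γ : Subgroup (Aut G))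
    (hi : AssociatedAnabelioidsStatementI SemiAnbdVocab.real.{u} 𝓐 G Γ)
    (hiia : LocHypotheses SemiAnbdVocab.real.{u} G Γ →
      ∀ Y : LocObj SemiAnbdVocab.real.{u} G Γ, Y.IsFiniteObj SemiAnbdVocab.real.{u} →
        ∃ (X G₀ : LocObj SemiAnbdVocab.real.{u} G Γ) (t : X ⟶ Y),
          Nonempty (X ⟶ G₀) ∧ G₀.U = G ∧ X.IsFiniteObj SemiAnbdVocab.real.{u} ∧
            G₀.IsFiniteObj SemiAnbdVocab.real.{u} ∧ finiteEtale t.hom.hom.hom)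
    (hiib : ∀ {H K K' : SgA.{u, u, u}} (s : H ⟶ K) (q : K' ⟶ K), finiteEtale q.hom.hom →
      ∃ c ∈ 𝓐.pullbackComponents s q, finiteEtale c.2.1.hom.hom)
    (hiic : ∀ {H L K : SgA.{u, u, u}} (a : H ⟶ L) (b : L ⟶ K),
      finiteEtale a.hom.hom → finiteEtale b.hom.hom → finiteEtale (a ≫ b).hom.hom) :
    Literature.AnabelianGeometry.SemiGraphs.Loc.AssociatedAnabelioidsStatementII
      SemiAnbdVocab.real.{u} G Γ :=
  associatedAnabelioidsStatementII_ofReal_of_statementI SgA.BridgeResidual.real 𝓐 G Γ hi hiia hiib hiic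

/-- **Prop 4.4 (i) at `SemiAnbdVocab.real` ⟸ Thm 1.2 (ii) (tree theorem)**, modulo the displayed laws of
`associatedAnabelioidsStatementI_ofReal_of_zmt` (`SgA.{u,u,u}`). [cite: MochizukiSemiAnbd2006, Prop 4.4 (i), p. 54] -/
theorem associatedAnabelioidsStatementI_real_of_zmt (𝓐 : AnabelioidVocab SgA.{u, u, u})
    (G : SgA.{u, u, u}) (Γ : Subgroup (Aut G))
    (hia : LocHypotheses SemiAnbdVocab.real.{u} G Γ →
      ∀ {X Y : LocObj SemiAnbdVocab.real.{u} G Γ} (f : X ⟶ Y),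
        X.IsFiniteObj SemiAnbdVocab.real.{u} → Y.IsFiniteObj SemiAnbdVocab.real.{u} →
          ∃ (Y₁ : SgA.{u, u, u}) (p₁ : Y₁ ⟶ Y.U) (A : SemiGraph.{u}) (φ : A ⟶ Y₁.toSgA.graph),
            finiteEtale p₁.hom.hom ∧ A.IsFinite ∧ Y₁.toSgA.graph.IsFinite ∧ SemiGraph.IsImmersion φ ∧
              ∀ (B' : SemiGraph.{u}) (π : B' ⟶ Y₁.toSgA.graph), SemiGraph.IsFiniteGraphCovering π →
                ∃ (Y₂ : SgA.{u, u, u}) (p₂ : Y₂ ⟶ Y₁), finiteEtale p₂.hom.hom ∧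
                  ∀ c ∈ 𝓐.pullbackComponents f.hom (p₂ ≫ p₁),
                    locallyTrivial c.2.2.hom.hom ∧
                      ∃ H : (SemiGraph.pullback φ π).Subgraph, H.toSemiGraph.IsConnected ∧
                        (SemiGraph.IsEmbedding (H.ι ≫ SemiGraph.pullback.snd φ π) →
                          SemiGraph.IsEmbedding c.2.2.hom.hom.base))
    (hib : ∀ {H L K : SgA.{u, u, u}} (a : H ⟶ L) (b : L ⟶ K),
      finiteEtale a.hom.hom → finiteEtale b.hom.hom → finiteEtale (a ≫ b).hom.hom) :
    Literature.AnabelianGeometry.SemiGraphs.Loc.AssociatedAnabelioidsStatementI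
      SemiAnbdVocab.real.{u} 𝓐 G Γ :=
  associatedAnabelioidsStatementI_ofReal_of_zmt SgA.BridgeResidual.real 𝓐 G Γ hia hib

end Loc

end Literature.AnabelianGeometry.SemiGraphs
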